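import Summits.KontsevichZagierPeriods.KontsevichZagierPeriods.Theses.HyperbolicBloch

/-!
# `PachnerTwoThree`: the interior hypothesis `0 < L u v q̂` is load-bearing (a.e. level)

Negative knowledge for the crux `HyperbolicBloch.PachnerTwoThree`
(stmt-KontsevichZagierPeriods-3470; refuter, cdisprove g2).  The geometric content of the crux is
the a.e. identity `prism(u,v,w) ∪ inner =ᵐ prism(u,v,q) ∪ prism(v,w,q) ∪ prism(w,u,q)` (true
under all three interior hypotheses, proved in `Cruxes/PachnerTwoThree/Disproof.lean`).  Here:
with the FIRST interior hypothesis `0 < L u v q̂` deleted the a.e. identity is FALSE.  Witness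
configuration `C₂ = (u, v, w, q) = (−5, 5, 5i, −2i)`: `q` lies below the edge `uv` but inside the
circumcircle, the other two interior hypotheses hold, the typed `prism(u,v,q)` is EMPTY
(clockwise triangle), and the box `[1,2] × [−1/2,−1/4] × [10,20]` (volume `5/2 > 0`) lies in
`prism(v,w,q)` but neither in `prism(u,v,w)` (`L u v < 0` there) nor in the inner region
(`S u v w > 0` there): the two sides differ by the whole prism over the clockwise triangle
`(u, v, q)`.  By the cyclic symmetry `(u,v,w) ↦ (v,w,u)` of the statement each of the three
interior hypotheses is load-bearing; at the KZ level see `…Disproof.lean` §5c.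
-/

noncomputable section

open Set MeasureTheory

namespace Summit.KontsevichZagierPeriods.HyperbolicBloch.WithoutInteriorAE

/-- **`0 < L u v q̂` is load-bearing for the crux `PachnerTwoThree` (a.e. level)**: the crux's
data verbatim, the first interior hypothesis deleted, conclusion = a.e. equality of the two unions
— FALSE.  Witness `C₂ = (−5, 5, 5i, −2i)` and the box `[1,2] × [−1/2,−1/4] × [10,20] ⊆ RHS ∖ LHS`. -/
theorem not_aeIdentity_without_interior₁ : ¬ (
  ∀ (L : ℂ → ℂ → (Fin 3 → ℝ) → ℝ), (∀ u v p, L u v p = (v.re - u.re) * (p 1 - u.im) - (v.im - u.im) * (p 0 - u.re)) →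
    ∀ (S : ℂ → ℂ → ℂ → (Fin 3 → ℝ) → ℝ), (∀ u v w p, S u v w p = (p 0 ^ 2 + p 1 ^ 2 + p 2 ^ 2) * (u.re * (v.im - w.im) - u.im * (v.re - w.re) + (v.re * w.im - v.im * w.re)) - p 0 * (Complex.normSq u * (v.im - w.im) - u.im * (Complex.normSq v - Complex.normSq w) + (Complex.normSq v * w.im - v.im * Complex.normSq w)) + p 1 * (Complex.normSq u * (v.re - w.re) - u.re * (Complex.normSq v - Complex.normSq w) + (Complex.normSq v * w.re - v.re * Complex.normSq w)) - (Complex.normSq u * (v.re * w.im - v.im * w.re) - u.re * (Complex.normSq v * w.im - v.im * Complex.normSq w) + u.im * (Complex.normSq v * w.re - v.re * Complex.normSq w))) →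
    ∀ (P : ℂ → ℂ → ℂ → Set (Fin 3 → ℝ)),
      (∀ u v w, P u v w = {p | 0 < p 2 ∧ 0 < L u v p ∧ 0 < L v w p ∧ 0 < L w u p ∧ 0 < S u v w p}) →
    ∀ (u v w q : ℂ), IsAlgebraic ℚ u → IsAlgebraic ℚ v → IsAlgebraic ℚ w → IsAlgebraic ℚ q →
      0 < L v w ![q.re, q.im, 0] → 0 < L w u ![q.re, q.im, 0] →
      (P u v w ∪ {p | 0 < p 2 ∧ S u v w p < 0 ∧ 0 < S u v q p ∧ 0 < S v w q p ∧ 0 < S w u q p} :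
          Set (Fin 3 → ℝ))
        =ᵐ[volume] (P u v q ∪ P v w q ∪ P w u q : Set (Fin 3 → ℝ))) := by
  intro h
  -- Gaussian integers are algebraic (`a + bi`, `i² + 1 = 0`)
  have isAlgebraic_mk_int : ∀ a b : ℤ, IsAlgebraic ℚ (⟨a, b⟩ : ℂ) := by
    intro a b
    have hI : IsAlgebraic ℚ Complex.I :=
      ⟨Polynomial.X ^ 2 + 1, Polynomial.Monic.ne_zero (by monicity!), by simp⟩
    have e : (⟨a, b⟩ : ℂ) = ((a : ℚ) : ℂ) + ((b : ℚ) : ℂ) * Complex.I := by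
      apply Complex.ext <;> simp
    rw [e]
    exact (isAlgebraic_algebraMap (R := ℚ) (A := ℂ) (a : ℚ)).add
      ((isAlgebraic_algebraMap (R := ℚ) (A := ℂ) (b : ℚ)).mul hI)
  have key := h (fun u v p => (v.re - u.re) * (p 1 - u.im) - (v.im - u.im) * (p 0 - u.re)) (fun _ _ _ => rfl) (fun u v w p => (p 0 ^ 2 + p 1 ^ 2 + p 2 ^ 2) * (u.re * (v.im - w.im) - u.im * (v.re - w.re) + (v.re * w.im - v.im * w.re)) - p 0 * (Complex.normSq u * (v.im - w.im) - u.im * (Complex.normSq v - Complex.normSq w) + (Complex.normSq v * w.im - v.im * Complex.normSq w)) + p 1 * (Complex.normSq u * (v.re - w.re) - u.re * (Complex.normSq v - Complex.normSq w) + (Complex.normSq v * w.re - v.re * Complex.normSq w)) - (Complex.normSq u * (v.re * w.im - v.im * w.re) - u.re * (Complex.normSq v * w.im - v.im * Complex.normSq w) + u.im * (Complex.normSq v * w.re - v.re * Complex.normSq w))) (fun _ _ _ _ => rfl)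
    (fun u v w => {p | 0 < p 2 ∧ 0 < ((v.re - u.re) * (p 1 - u.im) - (v.im - u.im) * (p 0 - u.re)) ∧ 0 < ((w.re - v.re) * (p 1 - v.im) - (w.im - v.im) * (p 0 - v.re)) ∧ 0 < ((u.re - w.re) * (p 1 - w.im) - (u.im - w.im) * (p 0 - w.re)) ∧ 0 < (p 0 ^ 2 + p 1 ^ 2 + p 2 ^ 2) * (u.re * (v.im - w.im) - u.im * (v.re - w.re) + (v.re * w.im - v.im * w.re)) - p 0 * (Complex.normSq u * (v.im - w.im) - u.im * (Complex.normSq v - Complex.normSq w) + (Complex.normSq v * w.im - v.im * Complex.normSq w)) + p 1 * (Complex.normSq u * (v.re - w.re) - u.re * (Complex.normSq v - Complex.normSq w) + (Complex.normSq v * w.re - v.re * Complex.normSq w)) - (Complex.normSq u * (v.re * w.im - v.im * w.re) - u.re * (Complex.normSq v * w.im - v.im * Complex.normSq w) + u.im * (Complex.normSq v * w.re - v.re * Complex.normSq w))})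
    (fun _ _ _ => rfl) ⟨-5, 0⟩ ⟨5, 0⟩ ⟨0, 5⟩ ⟨0, -2⟩
    (by simpa using isAlgebraic_mk_int (-5) 0) (by simpa using isAlgebraic_mk_int 5 0)
    (by simpa using isAlgebraic_mk_int 0 5) (by simpa using isAlgebraic_mk_int 0 (-2))
    (by norm_num) (by norm_num)
  have hnull := (ae_eq_set.mp key).2
  set a : Fin 3 → ℝ := ![1, -1 / 2, 10] with ha
  set b : Fin 3 → ℝ := ![2, -1 / 4, 20] with hb
  have hvol : volume (Icc a b) = 0 := by
    refine measure_mono_null ?_ hnull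
    intro p hp
    rw [mem_Icc] at hp
    have hx1 : 1 ≤ p 0 := by simpa [ha] using hp.1 0
    have hx2 : p 0 ≤ 2 := by simpa [hb] using hp.2 0
    have hy1 : -1 / 2 ≤ p 1 := by simpa [ha] using hp.1 1
    have hy2 : p 1 ≤ -1 / 4 := by simpa [hb] using hp.2 1
    have ht1 : 10 ≤ p 2 := by simpa [ha] using hp.1 2
    have ht2 : p 2 ≤ 20 := by simpa [hb] using hp.2 2
    have htt : 100 ≤ p 2 * p 2 := by nlinarith
    simp only [mem_sdiff, mem_union, mem_setOf_eq, Complex.normSq_mk, not_or, not_and]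
    norm_num
    refine ⟨Or.inl (Or.inr ⟨by linarith, by nlinarith, by nlinarith, by nlinarith, ?_⟩), ?_, ?_⟩
    · nlinarith [sq_nonneg (p 0), sq_nonneg (p 1)]
    · intro _ h1
      nlinarith
    · intro _ h1
      nlinarith [sq_nonneg (p 0), sq_nonneg (p 1)]
  rw [Real.volume_Icc_pi, Fin.prod_univ_three] at hvol
  simp [ha, hb] at hvol
  norm_num at hvol

end Summit.KontsevichZagierPeriods.HyperbolicBloch.WithoutInteriorAE
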